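import Summits.CriticalPhenomena.PercolationContinuityZ3.Theorems.PercNearOneGluingNoHeavyQuantGateMoveBlob
import HarnessLib

/-!
# QUANT lane R8, T-DEC, leg (III): THE TWIN MOVE LEMMA — the law-level form of the blob gate move (M) for a general blob size `a`:
# the conjecture `TwinMoveDEC` (exact census, 0 failures) and its layers `j < a` PROVED (criterion E) — part 1 of 2
# (part 2, `…QuantTwinMoveGateMove`: `TwinMoveDEC ⟹ (M) for every a ⟹ SDECUpTo is closed under slicing by ANY heavy blob {0,a;g}` = PM in full)

builds on p205010 (kernel theorem, internal audit signed; external expert review pending)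

Statement + support file (`--supports stmt-CriticalPhenomena-4575`), QUANT lane seat prim-quant-arm-1 (gen 39), rung R8 of
`run/shared/lean/prim/quant/LADDER.md`.  One `@[conjecture]` definition (`LawDec.TwinMoveDEC`), theorems with standard axioms, no sorries.  Part 1 of 2.
Continues typer g27's `…QuantGateMoveBlob` (the move lemma (M) `decAtT_gateMoveBlob`, proved when no unshifted atom lies strictly between
`0` and `a`; `sdecUpTo_slice_relay` = the case `a = 1`).  Memo `run/shared/lean/prim/quant/prim-quant-arm-1-g39/TWIN-MOVE-G39.md`.

THE FINDING (arm-1 g39, exact LP censuses `code/probe1…16.py`, kit j166456 on item 4575).  Write the hypothesis law of (M) as a MIXTURE: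
`slice ν a g = z·B + (1−z)·R` with `B = {0,a;g}` the blob and `R = slice ν̂ a g`, `ν̂ = (ν − zδ₀)/(1−z)`; the conclusion law is
`gate_{1−z} R = z·δ₀ + (1−z)·R`.  Then (M) holds for an ARBITRARY law `R` in place of `slice ν̂` PROVIDED ONLY that every atom `k < a` of `R`
(the zero included) has its TWIN: `(1−g)·R(k+a) ≥ g·R(k)` — the atoms `≥ a` of `R` are unconstrained (0 failures on ≈ 3 000 boundary-pushed local
instances + kit j166456; dropping the twin of one atom below `a`, or halving the twin ratio, produces failures; the analogous move of a NONZERO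
unshifted atom `k ↦ k` from `k + a`, and the full un-slice, are FALSE).  So the slice structure enters (M) only through the twins of the lows
below the blob; this is `TwinMoveDEC` below.  For the layers `j < a` it is a THEOREM here and does not even use the hypothesis on `Λ`: all lows
of `P` lie below `a`, their twins are giants, the twin inequalities give `Σ_{h ≤ j} R h ≤ 1 − g`, and criterion E for `P` at the worst case is
EXACTLY the side condition `y ≤ (1−z)g` (`twinMove_of_lt`).  For `j ≥ a` it is OPEN (the typer's sub-case (b), plus the new case `2a ≥ t`
with lows below `a`); the income criterion (`…QuantIncomeCriterion`, this seat) certifies the transferred routing in 520/522 exact instances and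
the residue by re-routing a low `l < a` to its twin.

* `LawDec.TwinMoveDEC` (`@[conjecture]`) — the twin move lemma, all layers.
* `LawDec.decAtT_of_giantMass_ge` — the E-regime: a probability law whose giants carry mass `≥ y` is DEC at every target (criterion E).
* **`LawDec.twinMove_of_lt`** — `TwinMoveDEC` at the layers `j < a`, unconditionally (criterion E; the hypothesis on `Λ` is not used).
* Part 2 (`…QuantTwinMoveGateMove`): `TwinMoveDEC ⟹` typer g27's `decAtT_gateMoveBlob` without the no-atom-below-`a` hypothesis
  (the move lemma (M) for every `a ≥ 1`) `⟹ SDECUpTo x Q M μ → SDECUpTo x Q (M+a) (slice μ a g)` for every heavy blob (PM in full).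

HONEST STATUS: `TwinMoveDEC` is OPEN for `j ≥ a`; `GateMove`, `GatedConvEmptyFree`, `SDECConvClosed`, `SingleGateConvClosed`, `TreeDEC`,
`FarTreeRow` remain OPEN; the RATE class log\* and the honest sentence of `run/shared/lean/prim/quant/README.md` are unchanged.

[this work]; (M), the flow transfer and `sdecUpTo_slice_relay`: prim-quant-stmt g27; slice theorem: prim-quant-stmt g24 / prim-quant-census-2
g54–g55 (this lane).  Nothing here is cited as a published result.  The gluing rows served [cite: KozmaNitzan2024, Conjecture 3 (p. 15)];
product measure [cite: Grimmett1999, §1.3 p. 10].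
-/

noncomputable section

namespace Summit.CriticalPhenomena.PercolationContinuityZ3.Theorems

namespace Quant

open Finset

/-- the two-point law `{lo, hi; g}` (as in `…QuantLawDEC`) -/
local notation3 "TP[" lo ", " hi ", " g ", " h "]" =>
  (g : ℝ) * (if (h : ℕ) = (hi : ℕ) then (1 : ℝ) else 0) + (1 - (g : ℝ)) * (if (h : ℕ) = (lo : ℕ) then (1 : ℝ) else 0)

namespace LawDec

/-- **CONJECTURE (THE TWIN MOVE LEMMA; arm-1 g39).**  `0 < y < 1`, `0 ≤ z < 1`, `g ≤ 1`, `y ≤ (1−z)·g`, `1 ≤ a ≤ N`; `R ≥ 0` a probability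
law on `{0..N}` whose atoms below `a` have TWINS (`g·R k ≤ (1−g)·R (k+a)` for every `k < a`; for `g = 1` this says `R` has no atom below `a`),
top-affordable after gating (`y·N ≤ (1−z)·mean R`).  If the mixture `Λ = z·{0,a;g} + (1−z)·R` is DEC at floor `y`, its own mean
`zag + (1−z)·mean R` and layer `j`, then the gated law `P = z·δ₀ + (1−z)·R` is DEC at floor `y`, its own mean `(1−z)·mean R` and layer `j`.
With `R = slice ν̂ a g` this is typer g27's move lemma (M) for every `a` (`decAtT_gateMoveBlob_of_twinMove`).  KNOWN: `j < a`
(`twinMove_of_lt`); no atom of `R` strictly between `0` and `a` (typer g27, `decAtT_gateMoveBlob`, for `R` a slice).  EVIDENCE: exact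
boundary-pushed LP censuses, 0 failures (module docstring; kit j166456 on item 4575); each twin and the ratio `g/(1−g)` are necessary.
builds on p205010 (kernel theorem, internal audit signed; external expert review pending). [this work] [status: open] -/
@[conjecture] def TwinMoveDEC : Prop :=
  ∀ (y z g : ℝ) (a j N : ℕ) (R : ℕ → ℝ),
    0 < y → y < 1 → 0 ≤ z → z < 1 → g ≤ 1 → y ≤ (1 - z) * g → 1 ≤ a → a ≤ N →
    (∀ h, 0 ≤ R h) → (∀ h, N < h → R h = 0) → (∑ h ∈ Finset.range (N + 1), R h = 1) →
    (∀ k, k < a → g * R k ≤ (1 - g) * R (k + a)) →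
    y * (N : ℝ) ≤ (1 - z) * ∑ h ∈ Finset.range (N + 1), (h : ℝ) * R h →
    DECAtT y (z * (a : ℝ) * g + (1 - z) * ∑ h ∈ Finset.range (N + 1), (h : ℝ) * R h) j N
      (fun h => z * TP[0, a, g, h] + (1 - z) * R h) →
    DECAtT y ((1 - z) * ∑ h ∈ Finset.range (N + 1), (h : ℝ) * R h) j N
      (fun h => z * (if h = 0 then (1 : ℝ) else 0) + (1 - z) * R h)

/-! ### The E-regime: giants carrying mass `≥ y` -/

/-- **THE E-REGIME.**  A probability law `A` on `{0..M}` (`A ≥ 0`, vanishing above `M`, mass `1`) whose giants `h ≥ j′+1` carry mass at least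
the floor `y` is DEC at `(y, T, j′)` for EVERY target `T`: the lows have mass `≤ 1 − Σ_giants ≤ 1 − y`, so `y/(1−y)·lows ≤ giants`
(criterion E, `flowAtT_of_giants`). [this work] -/
theorem decAtT_of_giantMass_ge (y T : ℝ) (j' M : ℕ) (A : ℕ → ℝ) (hy0 : 0 < y) (hy1 : y < 1)
    (hA0 : ∀ h, 0 ≤ A h) (hAM : ∀ h, M < h → A h = 0) (hA1 : ∑ h ∈ Finset.range (M + 1), A h = 1)
    (hG : y ≤ ∑ h ∈ Finset.Ico (j' + 1) (M + 1), A h) : DECAtT y T j' M A := by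
  refine decAtT_of_flowAtT y T j' M A hy0 hy1 hAM hA1 (flowAtT_of_giants y T j' M A hy0 hy1 hA0 ?_)
  have h1y : 0 < 1 - y := by linarith
  set G : ℝ := ∑ h ∈ Finset.Ico (j' + 1) (M + 1), A h with hGdef
  -- the lows have mass at most `1 − G`
  have hlows : ∑ l ∈ Finset.range (j' + 1), (if 2 * (l : ℝ) < T then A l else 0) ≤ 1 - G := by
    have h1 : ∑ l ∈ Finset.range (j' + 1), (if 2 * (l : ℝ) < T then A l else 0) ≤ ∑ l ∈ Finset.range (j' + 1), A l :=
      Finset.sum_le_sum fun l _ => by split_ifs; exacts [le_rfl, hA0 l]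
    by_cases hjM : j' + 1 ≤ M + 1
    · have hsplit := Finset.sum_range_add_sum_Ico A hjM
      rw [hA1] at hsplit
      linarith
    · -- no giants: `G = 0` and the lows have mass ≤ 1
      have hG0 : G = 0 := by
        rw [hGdef]; exact Finset.sum_eq_zero fun h hh => by have := (Finset.mem_Ico.1 hh); omega
      have h2 : ∑ l ∈ Finset.range (j' + 1), A l ≤ 1 := by
        have hMj : M + 1 ≤ j' + 1 := by omega
        have hz : ∑ h ∈ Finset.Ico (M + 1) (j' + 1), A h = 0 :=
          Finset.sum_eq_zero fun h hh => hAM h (by have := (Finset.mem_Ico.1 hh).1; omega)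
        rw [← Finset.sum_range_add_sum_Ico A hMj, hA1, hz]
        norm_num
      linarith
  calc y / (1 - y) * ∑ l ∈ Finset.range (j' + 1), (if 2 * (l : ℝ) < T then A l else 0)
      ≤ y / (1 - y) * (1 - G) := mul_le_mul_of_nonneg_left hlows (div_nonneg hy0.le h1y.le)
    _ ≤ G := by
        rw [div_mul_eq_mul_div, div_le_iff₀ h1y]
        nlinarith

/-! ### The layers below the blob: `j < a` -/

/-- reindexing: `Σ_{k ≤ j} R (k + a)` is at most the mass of `R` on `(j, N]` (`j < a`, `R ≥ 0`, `R = 0` above `N`). -/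
theorem sum_twins_le (R : ℕ → ℝ) (a j N : ℕ) (hja : j < a) (hR0 : ∀ h, 0 ≤ R h) (hRN : ∀ h, N < h → R h = 0) :
    ∑ k ∈ Finset.range (j + 1), R (k + a) ≤ ∑ h ∈ Finset.Ico (j + 1) (N + 1), R h := by
  have e1 : ∑ k ∈ Finset.range (j + 1), R (k + a) = ∑ h ∈ Finset.Ico a (a + (j + 1)), R h := by
    rw [Finset.sum_Ico_eq_sum_range]
    simp only [add_tsub_cancel_left]
    exact Finset.sum_congr rfl fun k _ => by rw [add_comm]
  rw [e1]
  by_cases hjN : j + 1 ≤ N + 1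
  · set L : ℕ := a + (j + 1) + N with hL
    have hsub : Finset.Ico a (a + (j + 1)) ⊆ Finset.Ico (j + 1) L := by
      intro h hh
      rw [Finset.mem_Ico] at hh ⊢
      omega
    have h1 : ∑ h ∈ Finset.Ico a (a + (j + 1)), R h ≤ ∑ h ∈ Finset.Ico (j + 1) L, R h :=
      Finset.sum_le_sum_of_subset_of_nonneg hsub fun h _ _ => hR0 h
    have h2 : ∑ h ∈ Finset.Ico (j + 1) L, R h = ∑ h ∈ Finset.Ico (j + 1) (N + 1), R h + ∑ h ∈ Finset.Ico (N + 1) L, R h :=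
      (Finset.sum_Ico_consecutive _ hjN (by omega)).symm
    have h3 : ∑ h ∈ Finset.Ico (N + 1) L, R h = 0 :=
      Finset.sum_eq_zero fun h hh => hRN h (by have := (Finset.mem_Ico.1 hh).1; omega)
    linarith
  · -- `N < j < a`: every twin lies above `N`
    have hz : ∑ h ∈ Finset.Ico a (a + (j + 1)), R h = 0 :=
      Finset.sum_eq_zero fun h hh => hRN h (by have := (Finset.mem_Ico.1 hh).1; omega)
    rw [hz]
    exact Finset.sum_nonneg fun h _ => hR0 h

/-- **THE TWIN MOVE LEMMA AT THE LAYERS `j < a` (unconditional; the hypothesis on `Λ` is not needed).**  With the data of `TwinMoveDEC`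
and `j < a`: every atom `h ≤ j` of `R` has its twin `h + a > j` among the giants, so `g·Σ_{h ≤ j} R h ≤ (1−g)·Σ_{h > j} R h`, i.e.
`u := Σ_{h ≤ j} R h ≤ 1 − g`; the lows of `P = z·δ₀ + (1−z)·R` have mass `≤ z + (1−z)u` and its giants have mass `(1−z)(1−u)`, and
`y·(z + (1−z)u) ≤ (1−y)(1−z)(1−u)` at the worst case `u = 1 − g` is exactly `y ≤ (1−z)g` (criterion E, `flowAtT_of_giants`).  Any target `T`.
[this work] -/
theorem twinMove_of_lt (y z g T : ℝ) (a j N : ℕ) (R : ℕ → ℝ)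
    (hy0 : 0 < y) (hy1 : y < 1) (hz0 : 0 ≤ z) (hz1 : z < 1) (hg1 : g ≤ 1) (hyg : y ≤ (1 - z) * g) (hja : j < a)
    (hR0 : ∀ h, 0 ≤ R h) (hRN : ∀ h, N < h → R h = 0) (hR1 : ∑ h ∈ Finset.range (N + 1), R h = 1)
    (htwin : ∀ k, k < a → g * R k ≤ (1 - g) * R (k + a)) :
    DECAtT y T j N (fun h => z * (if h = 0 then (1 : ℝ) else 0) + (1 - z) * R h) := by
  classical
  set P : ℕ → ℝ := fun h => z * (if h = 0 then (1 : ℝ) else 0) + (1 - z) * R h with hP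
  have h1z : 0 < 1 - z := by linarith
  have h1y : 0 < 1 - y := by linarith
  have hg0 : 0 < g := by
    by_contra hc
    have : (1 - z) * g ≤ 0 := mul_nonpos_of_nonneg_of_nonpos h1z.le (not_lt.1 hc)
    linarith
  have hP0 : ∀ h, 0 ≤ P h := fun h => by
    simp only [hP]; split_ifs <;> nlinarith [hR0 h]
  have hPN : ∀ h, N < h → P h = 0 := fun h hh => by
    simp only [hP]; rw [hRN h hh, if_neg (by omega)]; ring
  have hP1 : ∑ h ∈ Finset.range (N + 1), P h = 1 := by
    simp only [hP]
    rw [Finset.sum_add_distrib, ← Finset.mul_sum, ← Finset.mul_sum, hR1, Finset.sum_ite_eq' (Finset.range (N + 1)) 0,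
      if_pos (Finset.mem_range.2 (Nat.succ_pos N))]
    ring
  -- `u = Σ_{h ≤ j} R h`, the giant mass of `R` is at least `1 − u`, and the twins give `g·u ≤ (1−g)·(giant mass)`
  set u : ℝ := ∑ h ∈ Finset.range (j + 1), R h with hu
  set G : ℝ := ∑ h ∈ Finset.Ico (j + 1) (N + 1), R h with hG
  have hu0 : 0 ≤ u := Finset.sum_nonneg fun h _ => hR0 h
  have hG0 : 0 ≤ G := Finset.sum_nonneg fun h _ => hR0 h
  have htw : g * u ≤ (1 - g) * G := by
    have h1 : g * u ≤ (1 - g) * ∑ k ∈ Finset.range (j + 1), R (k + a) := by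
      rw [hu, Finset.mul_sum, Finset.mul_sum]
      exact Finset.sum_le_sum fun k hk => htwin k (by have := Finset.mem_range.1 hk; omega)
    exact h1.trans (mul_le_mul_of_nonneg_left (sum_twins_le R a j N hja hR0 hRN) (by linarith))
  -- `u + G = 1`: the mass of `R` on `{0..N}` splits over `{0..j}` and `(j, N]` (`N < j` is impossible: then `u = 1`, `G = 0`, `g ≤ 0`)
  by_cases hjN : j + 1 ≤ N + 1
  swap
  · exfalso
    have hG0' : G = 0 := by
      rw [hG]; exact Finset.sum_eq_zero fun h hh => by have := Finset.mem_Ico.1 hh; omega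
    have hu1 : u = 1 := by
      rw [hu, ← Finset.sum_range_add_sum_Ico R (show N + 1 ≤ j + 1 by omega), hR1,
        Finset.sum_eq_zero (fun h hh => hRN h (by have := (Finset.mem_Ico.1 hh).1; omega))]
      ring
    rw [hG0', hu1] at htw
    nlinarith
  have huG : u + G = 1 := by
    have := Finset.sum_range_add_sum_Ico R hjN
    rw [hR1] at this; linarith
  -- criterion E for `P`
  refine decAtT_of_flowAtT y T j N P hy0 hy1 hPN hP1 (flowAtT_of_giants y T j N P hy0 hy1 hP0 ?_)
  have hlows : ∑ l ∈ Finset.range (j + 1), (if 2 * (l : ℝ) < T then P l else 0) ≤ z + (1 - z) * u := by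
    have h1 : ∑ l ∈ Finset.range (j + 1), (if 2 * (l : ℝ) < T then P l else 0) ≤ ∑ l ∈ Finset.range (j + 1), P l :=
      Finset.sum_le_sum fun l _ => by split_ifs; exacts [le_rfl, hP0 l]
    have h2 : ∑ l ∈ Finset.range (j + 1), P l = z + (1 - z) * u := by
      simp only [hP]
      rw [Finset.sum_add_distrib, ← Finset.mul_sum, ← Finset.mul_sum, Finset.sum_ite_eq' (Finset.range (j + 1)) 0,
        if_pos (Finset.mem_range.2 (Nat.succ_pos j))]
      ring
    linarith
  have hgiants : ∑ h ∈ Finset.Ico (j + 1) (N + 1), P h = (1 - z) * G := by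
    simp only [hP]
    rw [Finset.sum_add_distrib, ← Finset.mul_sum, ← Finset.mul_sum,
      Finset.sum_eq_zero (fun h hh => by rw [if_neg (by have := (Finset.mem_Ico.1 hh).1; omega)])]
    ring
  rw [hgiants]
  -- `u ≤ 1 − g` from the twins, hence `y ≤ (1−z)g ≤ (1−z)(1−u) = (1−z)G`
  have hGu : G = 1 - u := by linarith
  have hu1g : u ≤ 1 - g := by
    rw [hGu] at htw
    have e : (1 - g) * (1 - u) = 1 - u - g + g * u := by ring
    rw [e] at htw; linarith
  have hyG : y ≤ (1 - z) * G := by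
    rw [hGu]
    exact hyg.trans (mul_le_mul_of_nonneg_left (by linarith) h1z.le)
  calc y / (1 - y) * ∑ l ∈ Finset.range (j + 1), (if 2 * (l : ℝ) < T then P l else 0)
      ≤ y / (1 - y) * (z + (1 - z) * u) := mul_le_mul_of_nonneg_left hlows (div_nonneg hy0.le h1y.le)
    _ ≤ (1 - z) * G := by
        rw [div_mul_eq_mul_div, div_le_iff₀ h1y]
        have e1 : z + (1 - z) * u = 1 - (1 - z) * G := by rw [hGu]; ring
        rw [e1]
        -- `y(1 − (1−z)G) ≤ (1−z)G(1−y)` ⟺ `y ≤ (1−z)G`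
        nlinarith [hyG]

end LawDec

end Quant

end Summit.CriticalPhenomena.PercolationContinuityZ3.Theorems
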